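import Mathlib

/-!
# Area-law slaving, part 1 — the regular solution of a first-order linear ODE at a regular singular point
# (`FilamentSkeletonRss`, child crux `TangentSkeletonNearStraight`, stmt-NavierStokesRegularity-28295, line
# `child_tangent_analytic_strip`, ∃-side of the registered stub `stub_analyticClosing`)

The flat clause block `FlatJ1G` of the child crux asks, along every filament, for a positive differentiable core
area `Aa` solving the AREA LAW `w·Aa′ = (3/2 − w′)·Aa + 4` through the transversal supercritical zero `c` of the slip
`w` (`w(c) = 0`, `w′(c) > 3/2`).  The zero of `w` is a REGULAR SINGULAR POINT of this linear ODE; the existence step of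
the line (stub `stub_analyticClosing`, step (v) of its docstring: "the transported areas are slaved, regular solution
`Aa(c) = 4/(w′(c) − 3/2)`") needs the regular solution to EXIST and to be differentiable AT the zero.  The tree so far
only has properties OF solutions (`Theorems.SkeletonJ1NormalBlockWindow.areaLaw_*`: value and bounds at the zero, slip
floor, unique zero for free).

This file is the abstract kernel: for `a, b ∈ C¹(ℝ)` with `a(0) = −ν`, `ν > 0`, `b > 0`, the singular equation
  `s · A′(s) = a(s) · A(s) + b(s)`                                                            (⋆)
has a positive differentiable solution on all of `ℝ` with `A(0) = b(0)/ν`, given by the EXPLICIT Frobenius formula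
  `A(s) = e^{P(s)} · ∫₀¹ t^{ν−1} φ(s t) dt`,  `P(s) = ∫₀ˢ ã`,  `s·ã(s) = a(s) + ν` (Hadamard quotient
  `ã(s) = ∫₀¹ a′(s t) dt`),  `φ = b · e^{−P}`,
whose verification is two one-line identities: the Euler identity `s·J′(s) = φ(s) − ν·J(s)` for
`J(s) = ∫₀¹ t^{ν−1} φ(st) dt` (fundamental theorem of calculus for `t ↦ t^ν φ(st)` on `[0,1]`) and
`(e^P)′ = ã e^P`.  No point is special in this representation, so differentiability at the singular point comes for free.

Main results: `mul_integral_deriv_comp_mul` (Hadamard), `hasDerivAt_eulerIntegral` / `euler_identity` /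
`eulerIntegral_zero` / `eulerIntegral_pos` (the Euler transform), `singular_regular_solution` (⋆).
Part 2 (`…AreaLawSlavingExistence`) instantiates (⋆) with `s = τ − c`, `a = (3/2 − w′)/g`, `b = 4/g`, `w = (τ−c)·g`.

HONEST FRAMING: elementary real analysis (Frobenius at a regular singular point, [Coddington–Levinson 1955, Ch. 4 §1];
folklore) serving a HYPOTHETICAL filament skeleton on the NEGATIVE side of a MODEL route; nothing here bears on
Navier–Stokes regularity or blow-up, and no registered stub is closed by this file.
`--supports stmt-NavierStokesRegularity-28295`.
-/

set_option linter.dupNamespace false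

noncomputable section

namespace Summit.NavierStokesRegularity.NavierStokesRegularity.Theorems.AreaLawSlaving

open Set MeasureTheory Real
open scoped Topology Interval

/-! ## §1 Hadamard quotient -/

/-- **Hadamard's lemma, integral form.**  For `f ∈ C¹(ℝ)`: `s · ∫₀¹ f′(s t) dt = f(s) − f(0)`. [folklore] -/
theorem mul_integral_deriv_comp_mul {f : ℝ → ℝ} (hf : ContDiff ℝ 1 f) (s : ℝ) :
    s * ∫ t in (0:ℝ)..1, deriv f (s * t) = f s - f 0 := by
  have h1 : s * ∫ t in (0:ℝ)..1, deriv f (s * t) = ∫ x in s * 0..s * 1, deriv f x := by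
    rw [← smul_eq_mul, intervalIntegral.smul_integral_comp_mul_left]
  rw [h1, mul_zero, mul_one]
  have hd : Differentiable ℝ f := hf.differentiable one_ne_zero
  have hc : Continuous (deriv f) := hf.continuous_deriv le_rfl
  exact intervalIntegral.integral_deriv_eq_sub (fun x _ => hd x) (hc.intervalIntegrable _ _)

/-- The Hadamard quotient `s ↦ ∫₀¹ f′(s t) dt` of a `C¹` function is continuous. [folklore] -/
theorem continuous_integral_deriv_comp_mul {f : ℝ → ℝ} (hf : ContDiff ℝ 1 f) :
    Continuous fun s : ℝ => ∫ t in (0:ℝ)..1, deriv f (s * t) := by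
  have hc : Continuous (deriv f) := hf.continuous_deriv le_rfl
  have hu : Continuous (Function.uncurry fun (s t : ℝ) => deriv f (s * t)) :=
    hc.comp (continuous_fst.mul continuous_snd)
  exact intervalIntegral.continuous_parametric_intervalIntegral_of_continuous' hu 0 1

/-! ## §2 The Euler transform `J(s) = ∫₀¹ t^{ν−1} φ(s t) dt` -/

/-- Points of `Ι 0 1` are in `(0, 1]`. [folklore] -/
theorem mem_uIoc_zero_one {t : ℝ} (ht : t ∈ Ι (0:ℝ) 1) : 0 < t ∧ t ≤ 1 := by
  rwa [Set.uIoc_of_le zero_le_one] at ht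

/-- `t ↦ t^{ν−1} g(t)` is interval-integrable on `[0,1]` for `ν > 0` and `g` continuous. [folklore] -/
theorem intervalIntegrable_rpow_mul {ν : ℝ} (hν : 0 < ν) {g : ℝ → ℝ} (hg : Continuous g) :
    IntervalIntegrable (fun t : ℝ => t ^ (ν - 1) * g t) volume 0 1 := by
  have h1 : IntervalIntegrable (fun t : ℝ => t ^ (ν - 1)) volume 0 1 :=
    intervalIntegral.intervalIntegrable_rpow' (by linarith)
  exact h1.mul_continuousOn hg.continuousOn

/-- `t ↦ t^{ν−1} φ(s t)` is continuous on `Ι 0 1`. [folklore] -/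
theorem continuousOn_rpow_mul_comp {ν : ℝ} {φ : ℝ → ℝ} (hφ : Continuous φ) (s : ℝ) :
    ContinuousOn (fun t : ℝ => t ^ (ν - 1) * φ (s * t)) (Ι (0:ℝ) 1) := by
  refine (continuousOn_id.rpow_const fun t ht => Or.inl (mem_uIoc_zero_one ht).1.ne').mul ?_
  exact (hφ.comp (continuous_const.mul continuous_id)).continuousOn

/-- **Derivative of the Euler transform.**  For `φ ∈ C¹(ℝ)` and `ν > 0`,
`J(s) = ∫₀¹ t^{ν−1} φ(st) dt` has derivative `∫₀¹ t^{ν−1} (φ′(st)·t) dt` at every `s` (differentiation under the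
integral sign, dominated by `t^{ν−1} · sup_{|x| ≤ |s|+1} |φ′(x)|`). [folklore] -/
theorem hasDerivAt_eulerIntegral {ν : ℝ} (hν : 0 < ν) {φ : ℝ → ℝ} (hφ : ContDiff ℝ 1 φ) (s₀ : ℝ) :
    HasDerivAt (fun s => ∫ t in (0:ℝ)..1, t ^ (ν - 1) * φ (s * t))
      (∫ t in (0:ℝ)..1, t ^ (ν - 1) * (deriv φ (s₀ * t) * t)) s₀ := by
  have hφd : Differentiable ℝ φ := hφ.differentiable one_ne_zero
  have hφ' : Continuous (deriv φ) := hφ.continuous_deriv le_rfl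
  obtain ⟨M, hM⟩ : ∃ M, ∀ x ∈ Icc (-(|s₀| + 1)) (|s₀| + 1), ‖deriv φ x‖ ≤ M :=
    isCompact_Icc.exists_bound_of_continuousOn hφ'.continuousOn
  have hM0 : 0 ≤ M := le_trans (norm_nonneg _) (hM 0 ⟨by have := abs_nonneg s₀; linarith,
    by have := abs_nonneg s₀; linarith⟩)
  have key := intervalIntegral.hasDerivAt_integral_of_dominated_loc_of_deriv_le
    (μ := volume) (a := (0:ℝ)) (b := 1)
    (F := fun s t => t ^ (ν - 1) * φ (s * t))
    (F' := fun s t => t ^ (ν - 1) * (deriv φ (s * t) * t))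
    (x₀ := s₀) (s := Metric.ball s₀ 1) (bound := fun t => t ^ (ν - 1) * M)
    (Metric.ball_mem_nhds s₀ one_pos) ?_ ?_ ?_ ?_ ?_ ?_
  · exact key.2
  · exact Filter.Eventually.of_forall fun x =>
      (continuousOn_rpow_mul_comp hφ.continuous x).aestronglyMeasurable measurableSet_uIoc
  · exact intervalIntegrable_rpow_mul hν (hφ.continuous.comp (continuous_const.mul continuous_id))
  · refine ContinuousOn.aestronglyMeasurable ?_ measurableSet_uIoc
    refine (continuousOn_id.rpow_const fun t ht => Or.inl (mem_uIoc_zero_one ht).1.ne').mul ?_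
    exact ((hφ'.comp (continuous_const.mul continuous_id)).mul continuous_id).continuousOn
  · refine Filter.Eventually.of_forall fun t ht x hx => ?_
    obtain ⟨ht0, ht1⟩ := mem_uIoc_zero_one ht
    have hx' : |x| ≤ |s₀| + 1 := by
      have h1 : dist x s₀ < 1 := hx
      rw [Real.dist_eq] at h1
      have := abs_sub_abs_le_abs_sub x s₀
      linarith
    have hxt : x * t ∈ Icc (-(|s₀| + 1)) (|s₀| + 1) := by
      have h2 : |x * t| ≤ |s₀| + 1 := by
        rw [abs_mul, abs_of_pos ht0]
        calc |x| * t ≤ |x| * 1 := mul_le_mul_of_nonneg_left ht1 (abs_nonneg x)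
          _ ≤ |s₀| + 1 := by rw [mul_one]; exact hx'
      exact ⟨(abs_le.mp h2).1, (abs_le.mp h2).2⟩
    have hd := hM (x * t) hxt
    rw [Real.norm_eq_abs] at hd ⊢
    rw [abs_mul, abs_mul, abs_of_nonneg (Real.rpow_nonneg ht0.le _), abs_of_pos ht0]
    have hpow : 0 ≤ t ^ (ν - 1) := Real.rpow_nonneg ht0.le _
    calc t ^ (ν - 1) * (|deriv φ (x * t)| * t) ≤ t ^ (ν - 1) * (M * 1) := by
          apply mul_le_mul_of_nonneg_left _ hpow
          exact mul_le_mul hd ht1 ht0.le hM0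
      _ = t ^ (ν - 1) * M := by rw [mul_one]
  · exact (intervalIntegral.intervalIntegrable_rpow' (by linarith)).mul_const M
  · refine Filter.Eventually.of_forall fun t _ x _ => ?_
    have h1 : HasDerivAt (fun x => φ (x * t)) (deriv φ (x * t) * t) x :=
      (hφd (x * t)).hasDerivAt.comp x (hasDerivAt_mul_const t)
    exact h1.const_mul _

/-- The derivative integrand rewritten with `t^ν`: `∫₀¹ t^{ν−1}(φ′(st)·t) dt = ∫₀¹ t^ν φ′(st) dt`. [folklore] -/
theorem eulerIntegral_deriv_eq {ν : ℝ} (hν : 0 < ν) (φ : ℝ → ℝ) (s : ℝ) :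
    ∫ t in (0:ℝ)..1, t ^ (ν - 1) * (deriv φ (s * t) * t) = ∫ t in (0:ℝ)..1, t ^ ν * deriv φ (s * t) := by
  refine intervalIntegral.integral_congr fun t ht => ?_
  rw [Set.uIcc_of_le zero_le_one] at ht
  show t ^ (ν - 1) * (deriv φ (s * t) * t) = t ^ ν * deriv φ (s * t)
  rcases ht.1.eq_or_lt with h | h
  · rw [← h, mul_zero (deriv φ (s * 0)), mul_zero, Real.zero_rpow hν.ne', zero_mul]
  · rw [Real.rpow_sub_one h.ne']
    field_simp

/-- The derivative of the Euler transform is continuous (hence `J ∈ C¹`). [folklore] -/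
theorem continuous_eulerIntegral_deriv {ν : ℝ} (hν : 0 < ν) {φ : ℝ → ℝ} (hφ : ContDiff ℝ 1 φ) :
    Continuous fun s => ∫ t in (0:ℝ)..1, t ^ (ν - 1) * (deriv φ (s * t) * t) := by
  have hφ' : Continuous (deriv φ) := hφ.continuous_deriv le_rfl
  have h : (fun s => ∫ t in (0:ℝ)..1, t ^ (ν - 1) * (deriv φ (s * t) * t)) =
      fun s => ∫ t in (0:ℝ)..1, t ^ ν * deriv φ (s * t) := funext fun s => eulerIntegral_deriv_eq hν φ s
  rw [h]
  have hu : Continuous (Function.uncurry fun (s t : ℝ) => t ^ ν * deriv φ (s * t)) :=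
    ((Real.continuous_rpow_const hν.le).comp continuous_snd).mul (hφ'.comp (continuous_fst.mul continuous_snd))
  exact intervalIntegral.continuous_parametric_intervalIntegral_of_continuous' hu 0 1

/-- The Euler transform of a `C¹` function is `C¹`. [folklore] -/
theorem contDiff_one_eulerIntegral {ν : ℝ} (hν : 0 < ν) {φ : ℝ → ℝ} (hφ : ContDiff ℝ 1 φ) :
    ContDiff ℝ 1 fun s => ∫ t in (0:ℝ)..1, t ^ (ν - 1) * φ (s * t) := by
  rw [contDiff_one_iff_deriv]
  refine ⟨fun s => (hasDerivAt_eulerIntegral hν hφ s).differentiableAt, ?_⟩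
  have h : deriv (fun s => ∫ t in (0:ℝ)..1, t ^ (ν - 1) * φ (s * t)) =
      fun s => ∫ t in (0:ℝ)..1, t ^ (ν - 1) * (deriv φ (s * t) * t) :=
    funext fun s => (hasDerivAt_eulerIntegral hν hφ s).deriv
  rw [h]
  exact continuous_eulerIntegral_deriv hν hφ

/-- **Euler identity.**  For `φ ∈ C¹(ℝ)`, `ν > 0` and every `s`:
`s · ∫₀¹ t^{ν−1}(φ′(st) t) dt = φ(s) − ν · ∫₀¹ t^{ν−1} φ(st) dt`
(fundamental theorem of calculus for `t ↦ t^ν φ(st)` on `[0,1]`). [folklore] -/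
theorem euler_identity {ν : ℝ} (hν : 0 < ν) {φ : ℝ → ℝ} (hφ : ContDiff ℝ 1 φ) (s : ℝ) :
    s * (∫ t in (0:ℝ)..1, t ^ (ν - 1) * (deriv φ (s * t) * t)) =
      φ s - ν * ∫ t in (0:ℝ)..1, t ^ (ν - 1) * φ (s * t) := by
  have hφd : Differentiable ℝ φ := hφ.differentiable one_ne_zero
  have hφ' : Continuous (deriv φ) := hφ.continuous_deriv le_rfl
  have hφc : Continuous φ := hφ.continuous
  have hφs : Continuous fun t : ℝ => φ (s * t) := hφc.comp (continuous_const.mul continuous_id)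
  have hG : ∀ t ∈ Ioo (0:ℝ) 1, HasDerivAt (fun t : ℝ => t ^ ν * φ (s * t))
      (ν * (t ^ (ν - 1) * φ (s * t)) + t ^ ν * (deriv φ (s * t) * s)) t := by
    intro t ht
    have h1 : HasDerivAt (fun t : ℝ => t ^ ν) (ν * t ^ (ν - 1)) t :=
      Real.hasDerivAt_rpow_const (Or.inl ht.1.ne')
    have h2 : HasDerivAt (fun t => φ (s * t)) (deriv φ (s * t) * s) t := by
      have := (hφd (s * t)).hasDerivAt.comp t ((hasDerivAt_id' t).const_mul s)
      simpa [Function.comp_def] using this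
    exact (h1.mul h2).congr_deriv (by ring)
  have hcont : ContinuousOn (fun t : ℝ => t ^ ν * φ (s * t)) (Icc 0 1) :=
    ((Real.continuous_rpow_const hν.le).mul hφs).continuousOn
  have hint1 : IntervalIntegrable (fun t : ℝ => ν * (t ^ (ν - 1) * φ (s * t))) volume 0 1 :=
    (intervalIntegrable_rpow_mul hν (g := fun t => φ (s * t)) hφs).const_mul ν
  have hint2 : IntervalIntegrable (fun t : ℝ => t ^ ν * (deriv φ (s * t) * s)) volume 0 1 :=
    (((Real.continuous_rpow_const hν.le).mul
      ((hφ'.comp (continuous_const.mul continuous_id)).mul continuous_const))).intervalIntegrable 0 1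
  have hftc := intervalIntegral.integral_eq_sub_of_hasDerivAt_of_le zero_le_one hcont hG (hint1.add hint2)
  rw [intervalIntegral.integral_add hint1 hint2] at hftc
  simp only [Real.one_rpow, one_mul, mul_one, Real.zero_rpow hν.ne', zero_mul, sub_zero] at hftc
  -- hftc : ∫ ν (t^(ν-1) φ(st)) + ∫ t^ν (φ'(st) s) = φ s
  have e1 : ∫ t in (0:ℝ)..1, ν * (t ^ (ν - 1) * φ (s * t)) = ν * ∫ t in (0:ℝ)..1, t ^ (ν - 1) * φ (s * t) :=
    intervalIntegral.integral_const_mul _ _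
  have e2 : ∫ t in (0:ℝ)..1, t ^ ν * (deriv φ (s * t) * s) =
      s * ∫ t in (0:ℝ)..1, t ^ (ν - 1) * (deriv φ (s * t) * t) := by
    rw [eulerIntegral_deriv_eq hν φ s, ← intervalIntegral.integral_const_mul]
    refine intervalIntegral.integral_congr fun t _ => ?_
    show t ^ ν * (deriv φ (s * t) * s) = s * (t ^ ν * deriv φ (s * t))
    ring
  rw [e1, e2] at hftc
  linarith

/-- Value of the Euler transform at `0`: `∫₀¹ t^{ν−1} φ(0) dt = φ(0)/ν`. [folklore] -/
theorem eulerIntegral_zero {ν : ℝ} (hν : 0 < ν) (φ : ℝ → ℝ) :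
    ∫ t in (0:ℝ)..1, t ^ (ν - 1) * φ (0 * t) = φ 0 / ν := by
  simp only [zero_mul]
  rw [intervalIntegral.integral_mul_const, integral_rpow (Or.inl (by linarith))]
  simp only [sub_add_cancel, Real.one_rpow, Real.zero_rpow hν.ne', sub_zero]
  field_simp

/-- Positivity of the Euler transform of a positive continuous function. [folklore] -/
theorem eulerIntegral_pos {ν : ℝ} (hν : 0 < ν) {φ : ℝ → ℝ} (hφ : Continuous φ) (hpos : ∀ x, 0 < φ x) (s : ℝ) :
    0 < ∫ t in (0:ℝ)..1, t ^ (ν - 1) * φ (s * t) :=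
  intervalIntegral.intervalIntegral_pos_of_pos_on
    (intervalIntegrable_rpow_mul hν (hφ.comp (continuous_const.mul continuous_id)))
    (fun _ ht => mul_pos (Real.rpow_pos_of_pos ht.1 _) (hpos _)) zero_lt_one

/-! ## §3 The regular solution at a regular singular point -/

/-- **Regular solution at a regular singular point (Frobenius, exponent `−ν < 0`).**  Let `a, b ∈ C¹(ℝ)` with
`a(0) = −ν`, `ν > 0`, and `b > 0` everywhere.  Then the singular linear equation `s·A′(s) = a(s)·A(s) + b(s)` has a
solution `A : ℝ → ℝ` which is differentiable EVERYWHERE (including `s = 0`), positive, with `A(0) = b(0)/ν`.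
(Explicitly `A = e^{P}·J`, `P = ∫₀ ã`, `s ã(s) = a(s) + ν`, `J(s) = ∫₀¹ t^{ν−1} (b e^{−P})(st) dt`.)
[Coddington–Levinson 1955, Ch. 4; folklore] -/
theorem singular_regular_solution {ν : ℝ} (hν : 0 < ν) {a b : ℝ → ℝ} (ha : ContDiff ℝ 1 a)
    (hb : ContDiff ℝ 1 b) (ha0 : a 0 = -ν) (hbpos : ∀ s, 0 < b s) :
    ∃ A : ℝ → ℝ, Differentiable ℝ A ∧ (∀ s, 0 < A s) ∧
      (∀ s, s * deriv A s = a s * A s + b s) ∧ A 0 = b 0 / ν := by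
  -- the Hadamard quotient `ah` of `a` at `0`: `s * ah s = a s + ν`
  obtain ⟨ah, hah⟩ : ∃ ah : ℝ → ℝ, ah = fun s => ∫ t in (0:ℝ)..1, deriv a (s * t) := ⟨_, rfl⟩
  have hah_cont : Continuous ah := by rw [hah]; exact continuous_integral_deriv_comp_mul ha
  have hah_mul : ∀ s, s * ah s = a s + ν := by
    intro s; rw [hah]; simp only; rw [mul_integral_deriv_comp_mul ha, ha0]; ring
  -- its primitive `P`
  obtain ⟨P, hP⟩ : ∃ P : ℝ → ℝ, P = fun s => ∫ σ in (0:ℝ)..s, ah σ := ⟨_, rfl⟩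
  have hPd : ∀ s, HasDerivAt P (ah s) s := by
    intro s; rw [hP]; exact (hah_cont.integral_hasStrictDerivAt 0 s).hasDerivAt
  have hP0 : P 0 = 0 := by rw [hP]; exact intervalIntegral.integral_same
  have hPC1 : ContDiff ℝ 1 P := by
    rw [contDiff_one_iff_deriv]
    refine ⟨fun s => (hPd s).differentiableAt, ?_⟩
    have : deriv P = ah := funext fun s => (hPd s).deriv
    rw [this]; exact hah_cont
  -- `φ = b e^{-P}`
  obtain ⟨φ, hφ⟩ : ∃ φ : ℝ → ℝ, φ = fun s => b s * Real.exp (-P s) := ⟨_, rfl⟩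
  have hφC1 : ContDiff ℝ 1 φ := by
    rw [hφ]; exact hb.mul (Real.contDiff_exp.comp hPC1.neg)
  have hφpos : ∀ s, 0 < φ s := fun s => by rw [hφ]; exact mul_pos (hbpos s) (Real.exp_pos _)
  have hEφ : ∀ s, Real.exp (P s) * φ s = b s := by
    intro s; rw [hφ]; simp only
    rw [Real.exp_neg, mul_comm (b s), ← mul_assoc, mul_inv_cancel₀ (Real.exp_pos _).ne', one_mul]
  -- the Euler transform `J` of `φ` and its derivative `J'`
  obtain ⟨J, hJ⟩ : ∃ J : ℝ → ℝ, J = fun s => ∫ t in (0:ℝ)..1, t ^ (ν - 1) * φ (s * t) := ⟨_, rfl⟩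
  obtain ⟨J', hJ'⟩ : ∃ J' : ℝ → ℝ, J' = fun s => ∫ t in (0:ℝ)..1, t ^ (ν - 1) * (deriv φ (s * t) * t) :=
    ⟨_, rfl⟩
  have hJd : ∀ s, HasDerivAt J (J' s) s := by
    intro s; rw [hJ, hJ']; exact hasDerivAt_eulerIntegral hν hφC1 s
  have hJeuler : ∀ s, s * J' s = φ s - ν * J s := by
    intro s; rw [hJ, hJ']; exact euler_identity hν hφC1 s
  have hJpos : ∀ s, 0 < J s := by
    intro s; rw [hJ]; exact eulerIntegral_pos hν hφC1.continuous hφpos s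
  have hJ0 : J 0 = φ 0 / ν := by rw [hJ]; exact eulerIntegral_zero hν φ
  -- `A = e^P J`
  have hA : ∀ s, HasDerivAt (fun s => Real.exp (P s) * J s)
      (Real.exp (P s) * ah s * J s + Real.exp (P s) * J' s) s :=
    fun s => (hPd s).exp.mul (hJd s)
  refine ⟨fun s => Real.exp (P s) * J s, fun s => (hA s).differentiableAt,
    fun s => mul_pos (Real.exp_pos _) (hJpos s), fun s => ?_, ?_⟩
  · rw [(hA s).deriv]
    calc s * (Real.exp (P s) * ah s * J s + Real.exp (P s) * J' s)
        = Real.exp (P s) * ((s * ah s) * J s + s * J' s) := by ring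
      _ = Real.exp (P s) * ((a s + ν) * J s + (φ s - ν * J s)) := by rw [hah_mul, hJeuler]
      _ = a s * (Real.exp (P s) * J s) + Real.exp (P s) * φ s := by ring
      _ = a s * (Real.exp (P s) * J s) + b s := by rw [hEφ]
  · simp only [hP0, Real.exp_zero, one_mul, hJ0]
    have : φ 0 = b 0 := by rw [hφ]; simp [hP0]
    rw [this]

end Summit.NavierStokesRegularity.NavierStokesRegularity.Theorems.AreaLawSlaving

end
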